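import Summits.AnomalousDissipation.AnomalousDissipation.Theorems.MarginalStabilityChainChainRealisationStubPhaseOfCompactLimitsB
import Literature.Analysis.FluidPDE.PeriodicBoundedMildTorus
import HarnessLib

/-!
# Stub `stub_phaseOfCompactLimits` of the line `SketchIdeator2` (card `separatrix-flux-pinning`)
# (crux `MarginalStabilityChain.ChainRealisation`, stmt-AnomalousDissipation-14249)

Sorry-free discharge of the registered stub `stub_phaseOfCompactLimits` (B6) of the lead's skeleton
(`Cruxes/ChainRealisation/Lines/SketchIdeator2.lean`, §2b): **the NS phase from compact limits of
time-translates.**  Let `u` be a forward classical solution of NS_ν (`ν ≥ 0`, steady force `F`) on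
`[0,∞) × T³` with mean-zero slices such that (COMP) every sequence of forward translates
`u(sₙ + ·)`, `sₙ ≥ 0`, has a subsequence converging in `L²` and in `Ḣ¹`, uniformly on every `[0,T]`,
to a forward classical mean-zero solution.  Then there is an NS phase `(K, φ)` (`IsNSPhase ν F K φ`:
`K ⊂ H` compact, `φ` a jointly continuous semiflow of classical solutions on `K` with finite,
continuous enstrophy) and `x₀ ∈ K` whose orbit is represented by `u`.

**Proof.**  Let `P` ("limit trajectories") be the family of velocities `v` of classical mean-zero
solutions on `Ici 0` which are APPROXIMABLE BY TRANSLATES of `u`: for all `T ≥ 0`, `ε > 0` some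
translate `u(s + ·)`, `s ≥ 0`, is `ε`-close to `v` in `L²` and `Ḣ¹` on `[0,T]`.  Then
* `u ∈ P` (`s = 0`; `phaseCL_traj_self`);
* `P` is invariant under forward shifts (`Torus.IsClassicalNSSolutionOn.comp_add_const` and `mono`;
  `phaseCL_traj_shift`);
* forward uniqueness from the time-`0` slice holds in `P`
  (`Torus.IsClassicalNSSolutionOn.velocity_unique_of_mem`, Majda–Bertozzi 2002 Cor. 3.1);
* COMPACTNESS (`phaseCL_traj_seqCompact`): given `vₖ ∈ P`, choose translates `u(s'ₖ + ·)` which are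
  `1/(k+1)`-close to `vₖ` on `[0,k]`, apply COMP to `s'`, and use the two-out-of-three inequalities
  in `L²` and `Ḣ¹`; the limit is again approximable by translates.
The abstract assembly `phaseCL_assemble` (helper file B: `K` = classes of time-`0` slices of members
of `P`, `φ t x = [v_x t]`, compactness / joint continuity / enstrophy continuity by the
sub-subsequence principle) then yields the phase, with `x₀ = [u 0]`.

References: C. Foias, O. Manley, R. Rosa, R. Temam, *Navier–Stokes Equations and Turbulence*
(CUP 2001), Ch. III §2, Ch. IV §1; A. J. Majda, A. L. Bertozzi, *Vorticity and Incompressible Flow*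
(CUP 2002), Cor. 3.1.
-/

set_option linter.dupNamespace false

noncomputable section

open MeasureTheory Set Filter Topology
open scoped InnerProductSpace
open Literature.Analysis.FunctionSpaces Literature.Analysis.FunctionSpaces.Torus
open Literature.Analysis.FluidPDE

namespace Summit.AnomalousDissipation.AnomalousDissipation.Theorems.ChainRealisation.SeparatrixFluxPinning

open Summit.AnomalousDissipation.AnomalousDissipation.Theorems.DenseLoudDesignerForces.Ergodic
open Literature.Analysis.FluidPDE.Torus

/-! ## The family of limit trajectories: base point, shifts, compactness -/

/-- `u` itself is approximable by its translates (`s = 0`). -/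
theorem phaseCL_traj_self {ν : ℝ} {F : UnitAddTorus (Fin 3) → EuclideanSpace ℝ (Fin 3)}
    {u : ℝ → UnitAddTorus (Fin 3) → EuclideanSpace ℝ (Fin 3)} {p : ℝ → UnitAddTorus (Fin 3) → ℝ}
    (hsol : IsClassicalNSSolutionOn (Ici 0) ν (fun _ => F) u p) :
    ∀ T ε : ℝ, 0 ≤ T → 0 < ε → ∃ s : ℝ, 0 ≤ s ∧ ∀ t ∈ Icc 0 T,
      (∫ x, ‖u (s + t) x - u t x‖ ^ 2) ≤ ε ∧ gradNormSq (fun x => u (s + t) x - u t x) ≤ ε := by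
  intro T ε _hT hε
  refine ⟨0, le_rfl, fun t ht => ?_⟩
  have hsm : IsSmooth (u t) := hsol.smooth_velocity.isSmooth_slice (mem_Ici.2 ht.1)
  rw [zero_add]
  refine ⟨?_, ?_⟩
  · have h : (fun x => ‖u t x - u t x‖ ^ 2) = fun _ => (0 : ℝ) := by
      funext x
      rw [sub_self, norm_zero]
      ring
    rw [h, integral_zero]
    exact hε.le
  · rw [phaseCL_gradNormSq_sub_self hsm]
    exact hε.le

/-- **Shift invariance of the limit trajectories**: if `(v, q)` is a classical mean-zero solution on
`Ici 0` approximable by translates of `u`, so is `(v(· + τ), q(· + τ))` for `τ ≥ 0` (autonomy of the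
system with steady force, `Torus.IsClassicalNSSolutionOn.comp_add_const`; translates `u(s + τ + ·)`). -/
theorem phaseCL_traj_shift {ν : ℝ} {F : UnitAddTorus (Fin 3) → EuclideanSpace ℝ (Fin 3)}
    {u v : ℝ → UnitAddTorus (Fin 3) → EuclideanSpace ℝ (Fin 3)} {q : ℝ → UnitAddTorus (Fin 3) → ℝ}
    (hv : IsClassicalNSSolutionOn (Ici 0) ν (fun _ => F) v q)
    (hvz : ∀ t : ℝ, 0 ≤ t → HasZeroMean (v t))
    (happ : ∀ T ε : ℝ, 0 ≤ T → 0 < ε → ∃ s : ℝ, 0 ≤ s ∧ ∀ t ∈ Icc 0 T,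
      (∫ x, ‖u (s + t) x - v t x‖ ^ 2) ≤ ε ∧ gradNormSq (fun x => u (s + t) x - v t x) ≤ ε)
    {τ : ℝ} (hτ : 0 ≤ τ) :
    IsClassicalNSSolutionOn (Ici 0) ν (fun _ => F) (fun t => v (t + τ)) (fun t => q (t + τ)) ∧
      (∀ t : ℝ, 0 ≤ t → HasZeroMean (v (t + τ))) ∧
      ∀ T ε : ℝ, 0 ≤ T → 0 < ε → ∃ s : ℝ, 0 ≤ s ∧ ∀ t ∈ Icc 0 T,
        (∫ x, ‖u (s + t) x - v (t + τ) x‖ ^ 2) ≤ ε ∧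
          gradNormSq (fun x => u (s + t) x - v (t + τ) x) ≤ ε := by
  refine ⟨(hv.comp_add_const τ).mono (fun t ht => ?_) (uniqueDiffOn_Ici 0),
    fun t ht => hvz _ (by linarith), fun T ε hT hε => ?_⟩
  · simp only [mem_preimage, mem_Ici] at ht ⊢
    linarith
  · obtain ⟨s, hs, h⟩ := happ (T + τ) ε (by linarith) hε
    refine ⟨s + τ, by linarith, fun t ht => ?_⟩
    have e : s + τ + t = s + (t + τ) := by ring
    rw [e]
    exact h (t + τ) ⟨by linarith [ht.1], by linarith [ht.2]⟩

/-- **Compactness of the limit trajectories modulo COMP.**  Every sequence `vₖ` of classical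
mean-zero solutions approximable by translates of `u` has a subsequence converging, in `L²` and `Ḣ¹`
uniformly on every `[0,T]`, to such a solution: choose translates `u(s'ₖ + ·)` `1/(k+1)`-close to
`vₖ` on `[0,k]`, extract with COMP along `s'`, and combine by the two-out-of-three inequalities. -/
theorem phaseCL_traj_seqCompact {ν : ℝ} {F : UnitAddTorus (Fin 3) → EuclideanSpace ℝ (Fin 3)}
    {u : ℝ → UnitAddTorus (Fin 3) → EuclideanSpace ℝ (Fin 3)} {p : ℝ → UnitAddTorus (Fin 3) → ℝ}
    (hsol : IsClassicalNSSolutionOn (Ici 0) ν (fun _ => F) u p)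
    (hcomp : ∀ s : ℕ → ℝ, (∀ n, 0 ≤ s n) →
      ∃ φ : ℕ → ℕ, StrictMono φ ∧ ∃ (v : ℝ → UnitAddTorus (Fin 3) → EuclideanSpace ℝ (Fin 3))
        (q : ℝ → UnitAddTorus (Fin 3) → ℝ),
        IsClassicalNSSolutionOn (Ici 0) ν (fun _ => F) v q ∧
        (∀ t : ℝ, 0 ≤ t → HasZeroMean (v t)) ∧
        ∀ T ε : ℝ, 0 ≤ T → 0 < ε → ∀ᶠ n in atTop, ∀ t ∈ Icc 0 T,
          (∫ x, ‖u (s (φ n) + t) x - v t x‖ ^ 2) ≤ ε ∧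
            gradNormSq (fun x => u (s (φ n) + t) x - v t x) ≤ ε)
    (vs : ℕ → ℝ → UnitAddTorus (Fin 3) → EuclideanSpace ℝ (Fin 3))
    (hvs : ∀ k, ∃ q : ℝ → UnitAddTorus (Fin 3) → ℝ,
      IsClassicalNSSolutionOn (Ici 0) ν (fun _ => F) (vs k) q ∧
      (∀ t : ℝ, 0 ≤ t → HasZeroMean (vs k t)) ∧
      ∀ T ε : ℝ, 0 ≤ T → 0 < ε → ∃ s : ℝ, 0 ≤ s ∧ ∀ t ∈ Icc 0 T,
        (∫ x, ‖u (s + t) x - vs k t x‖ ^ 2) ≤ ε ∧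
          gradNormSq (fun x => u (s + t) x - vs k t x) ≤ ε) :
    ∃ ψ : ℕ → ℕ, StrictMono ψ ∧ ∃ v : ℝ → UnitAddTorus (Fin 3) → EuclideanSpace ℝ (Fin 3),
      (∃ q : ℝ → UnitAddTorus (Fin 3) → ℝ, IsClassicalNSSolutionOn (Ici 0) ν (fun _ => F) v q ∧
        (∀ t : ℝ, 0 ≤ t → HasZeroMean (v t)) ∧
        ∀ T ε : ℝ, 0 ≤ T → 0 < ε → ∃ s : ℝ, 0 ≤ s ∧ ∀ t ∈ Icc 0 T,
          (∫ x, ‖u (s + t) x - v t x‖ ^ 2) ≤ ε ∧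
            gradNormSq (fun x => u (s + t) x - v t x) ≤ ε) ∧
      ∀ T ε : ℝ, 0 ≤ T → 0 < ε → ∀ᶠ n in atTop, ∀ t ∈ Icc 0 T,
        (∫ x, ‖vs (ψ n) t x - v t x‖ ^ 2) ≤ ε ∧
          gradNormSq (fun x => vs (ψ n) t x - v t x) ≤ ε := by
  -- translates approximating `vₖ` on `[0,k]` within `1/(k+1)`
  have hchoice : ∀ k : ℕ, ∃ s : ℝ, 0 ≤ s ∧ ∀ t ∈ Icc 0 (k : ℝ),
      (∫ x, ‖u (s + t) x - vs k t x‖ ^ 2) ≤ 1 / ((k : ℝ) + 1) ∧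
        gradNormSq (fun x => u (s + t) x - vs k t x) ≤ 1 / ((k : ℝ) + 1) := fun k => by
    obtain ⟨_, _, _, happ⟩ := hvs k
    exact happ k (1 / ((k : ℝ) + 1)) (Nat.cast_nonneg k) (by positivity)
  choose s hs0 hs using hchoice
  obtain ⟨ψ, hψ, v, q, hv, hvz, hconv⟩ := hcomp s hs0
  refine ⟨ψ, hψ, v, ⟨q, hv, hvz, fun T ε hT hε => ?_⟩, fun T ε hT hε => ?_⟩
  · obtain ⟨n, hn⟩ := (hconv T ε hT hε).exists
    exact ⟨s (ψ n), hs0 _, hn⟩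
  · have hε4 : 0 < ε / 4 := by positivity
    have hE1 := hconv T (ε / 4) hT hε4
    have hE2 : ∀ᶠ n in atTop, T ≤ (ψ n : ℝ) :=
      (tendsto_natCast_atTop_atTop.comp hψ.tendsto_atTop).eventually_ge_atTop T
    have hE3 : ∀ᶠ n in atTop, 1 / ((ψ n : ℝ) + 1) ≤ ε / 4 :=
      ((tendsto_one_div_add_atTop_nhds_zero_nat (𝕜 := ℝ)).comp hψ.tendsto_atTop).eventually
        (Iic_mem_nhds hε4)
    filter_upwards [hE1, hE2, hE3] with n h1 h2 h3 t ht
    have hA := hs (ψ n) t ⟨ht.1, ht.2.trans h2⟩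
    have hB := h1 t ht
    have hsu : IsSmooth (u (s (ψ n) + t)) :=
      hsol.smooth_velocity.isSmooth_slice (mem_Ici.2 (add_nonneg (hs0 _) ht.1))
    obtain ⟨_, hk, -, -⟩ := hvs (ψ n)
    have hsk : IsSmooth (vs (ψ n) t) := hk.smooth_velocity.isSmooth_slice (mem_Ici.2 ht.1)
    have hsv : IsSmooth (v t) := hv.smooth_velocity.isSmooth_slice (mem_Ici.2 ht.1)
    constructor
    · have htri := phaseCL_integral_tri hsk.continuous hsu.continuous hsv.continuous
      have hswap : (fun x => ‖vs (ψ n) t x - u (s (ψ n) + t) x‖ ^ 2) =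
          fun x => ‖u (s (ψ n) + t) x - vs (ψ n) t x‖ ^ 2 := by
        funext x
        rw [norm_sub_rev]
      rw [hswap] at htri
      linarith [hA.1, hB.1]
    · have htri := phaseCL_gradNormSq_tri hsk hsu hsv
      rw [phaseCL_gradNormSq_sub_comm hsk hsu] at htri
      linarith [hA.2, hB.2]

/-! ## The stub -/

/-- Stub B6 (L) **THE NS PHASE FROM COMPACT LIMITS OF SHIFTS** (soft).  A forward classical solution
`u` with mean-zero slices (`ν ≥ 0`) all of whose sequences of forward translates have subsequences
converging in `L²`/`Ḣ¹`, locally uniformly in time, to forward classical mean-zero solutions, lies on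
an NS phase: `K` = classes in `H` of the time-`0` slices of the limit trajectories (classical mean-zero
solutions approximable by translates of `u`), `φ t x = [v_x t]` for a chosen limit trajectory through
`x` (well defined and a semiflow by forward uniqueness, `Torus.IsClassicalNSSolutionOn.velocity_unique_of_mem`),
`K` compact and `φ`, `enstrophyObs` continuous by compactness modulo COMP and the sub-subsequence
principle (`phaseCL_assemble`), `x₀ = [u 0]`.  (FMRT 2001 Ch. III §2, Ch. IV §1.) -/
theorem stub_phaseOfCompactLimits :
    ∀ (ν : ℝ) (F : UnitAddTorus (Fin 3) → EuclideanSpace ℝ (Fin 3))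
      (u : ℝ → UnitAddTorus (Fin 3) → EuclideanSpace ℝ (Fin 3)) (p : ℝ → UnitAddTorus (Fin 3) → ℝ),
      0 ≤ ν → IsClassicalNSSolutionOn (Set.Ici 0) ν (fun _ => F) u p →
      (∀ t : ℝ, 0 ≤ t → HasZeroMean (u t)) →
      (∀ s : ℕ → ℝ, (∀ n, 0 ≤ s n) →
        ∃ φ : ℕ → ℕ, StrictMono φ ∧ ∃ (v : ℝ → UnitAddTorus (Fin 3) → EuclideanSpace ℝ (Fin 3))
          (q : ℝ → UnitAddTorus (Fin 3) → ℝ),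
          IsClassicalNSSolutionOn (Set.Ici 0) ν (fun _ => F) v q ∧
          (∀ t : ℝ, 0 ≤ t → HasZeroMean (v t)) ∧
          ∀ T ε : ℝ, 0 ≤ T → 0 < ε → ∀ᶠ n in atTop, ∀ t ∈ Set.Icc 0 T,
            (∫ x, ‖u (s (φ n) + t) x - v t x‖ ^ 2) ≤ ε ∧
              gradNormSq (fun x => u (s (φ n) + t) x - v t x) ≤ ε) →
      ∃ (K : Set Hsp) (φ : ℝ → Hsp → Hsp) (x₀ : Hsp), IsNSPhase ν F K φ ∧ x₀ ∈ K ∧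
        ∀ t : ℝ, 0 ≤ t → rep (φ t x₀) =ᵐ[volume] u t := by
  intro ν F u p hν hsol hzm hcomp
  refine phaseCL_assemble ν F
    (fun v => ∃ q : ℝ → UnitAddTorus (Fin 3) → ℝ,
      IsClassicalNSSolutionOn (Ici 0) ν (fun _ => F) v q ∧ (∀ t : ℝ, 0 ≤ t → HasZeroMean (v t)) ∧
      ∀ T ε : ℝ, 0 ≤ T → 0 < ε → ∃ s : ℝ, 0 ≤ s ∧ ∀ t ∈ Icc 0 T,
        (∫ x, ‖u (s + t) x - v t x‖ ^ 2) ≤ ε ∧ gradNormSq (fun x => u (s + t) x - v t x) ≤ ε)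
    u ?_ ?_ ?_ ?_ ?_ ⟨p, hsol, hzm, phaseCL_traj_self hsol⟩
  · rintro v ⟨q, hq, -, -⟩
    exact ⟨q, hq⟩
  · rintro v ⟨-, -, hz, -⟩
    exact hz
  · rintro v ⟨q, hq, hz, happ⟩ τ hτ
    obtain ⟨h1, h2, h3⟩ := phaseCL_traj_shift hq hz happ hτ
    exact ⟨fun t => q (t + τ), h1, h2, h3⟩
  · rintro v w ⟨q, hq, -, -⟩ ⟨q', hq', -, -⟩ h0 t ht
    exact hq.velocity_unique_of_mem hν (convex_Ici 0) hq' (t₀ := 0) (mem_Ici.2 le_rfl) h0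
      (mem_Ici.2 ht) ht
  · intro vs hvs
    exact phaseCL_traj_seqCompact hsol hcomp vs hvs

end Summit.AnomalousDissipation.AnomalousDissipation.Theorems.ChainRealisation.SeparatrixFluxPinning

end
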